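import Mathlib.RingTheory.SimpleModule.IsAlgClosed
import Mathlib.RingTheory.Congruence.Hom
import Mathlib.RingTheory.TwoSidedIdeal.Kernel
import Mathlib.RingTheory.TwoSidedIdeal.Operations
import Mathlib.Algebra.Algebra.Opposite
import Mathlib.Algebra.Algebra.Prod
import Mathlib.LinearAlgebra.Matrix.ToLin
import Literature.RingTheory.CentralSimple.AdjointAntiAutomorphismsBilinearForms
import Literature.NumberTheory.Kottwitz1992.Involutions
import HarnessLib

/-!
# [Kottwitz1992, §1 p. 378] Irreducible semisimple algebras with involution over an algebraically closed field —
# DISCHARGED: `Kottwitz1992_1_irreducible_classification_holds`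

Kernel-lane companion of the statement carpet ★ `Literature/NumberTheory/Kottwitz1992/Involutions.lean` (squad TK, TK-t01): the named
fact ★ `Involutions.Kottwitz1992_1_irreducible_classification` — for `F` algebraically closed of characteristic zero and `(B, *)`
finite-dimensional semisimple and irreducible, EITHER «the pair consisting of `B` and `*` is isomorphic to the algebra of endomorphisms of
a finite-dimensional nondegenerate quadratic or symplectic vector space over `F` with involution given by the adjoint map for the given
bilinear form», OR «`B` is isomorphic to a product `M × M^opp` with involution given by `(x, y) ↦ (y, x)`, where `M` is a matrix
algebra» — is PROVED here as `theorem Kottwitz1992_1_irreducible_classification_holds : Kottwitz1992_1_irreducible_classification F B ι`.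
THEOREMS ONLY (no definition, no named fact, no `sorry`, no instance, no notation); cell hodgecm-mathlib, seat B-typ04 (g30); net debt −1.

R. E. Kottwitz, *Points on some Shimura varieties over finite fields*, J. Amer. Math. Soc. 5 (1992), §1 p. 378 L29–L41 (held
`paper:doi-10-2307-2152772`, p0006).  THE PRINT: «Suppose that `F` is algebraically closed. Since the involution permutes the simple
factors of `B`, the algebra `B` with involution is a product of semisimple algebras with involution, with each factor either simple or
else the product of two simple algebras interchanged by `*`. Thus, in classifying semisimple algebras with involution, we may as well
suppose that we are in one of these two irreducible cases. In the first case `B` is a matrix algebra over `F` and the involution differs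
from the standard transpose involution by an inner automorphism `x ↦ y x y⁻¹`. The equality `x** = x` implies that `y` is either
symmetric or alternating, hence that the pair consisting of `B` and `*` is isomorphic to the algebra of endomorphisms of a
finite-dimensional nondegenerate quadratic or symplectic vector space over `F` with involution given by the adjoint map for the given
bilinear form. In the second case `B` is isomorphic to a product `M × M^opp` with involution given by `(x, y) ↦ (y, x)`, where `M` is a
matrix algebra and `M^opp` denotes the opposite algebra.»

THE PRINTED PROOF, FOLLOWED.  The typed letter starts from an IRREDUCIBLE `(B, *)` (★ `IsIrreducible`: `B ≠ 0` and the only `*`-stable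
two-sided ideals are `0` and `B`), so «we are in one of these two irreducible cases» is the dichotomy `B` simple ∕ `B` not simple:
* §2 «In the first case `B` is a matrix algebra over `F`» — Mathlib's Wedderburn–Artin over an algebraically closed field
  (`IsSimpleRing.exists_algEquiv_matrix_of_isAlgClosed`, `Matrix.toLinAlgEquiv'`: `B ≅ M_n(F) = End_F(F^n)`); «the involution differs
  from the standard transpose involution by an inner automorphism … `y` is either symmetric or alternating, hence … the adjoint map for
  the given bilinear form» — this is the Theorem of Knus–Merkurjev–Rost–Tignol, Ch. I (Skolem–Noether inside), a THEOREM of the tree used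
  BY NAME: ★ `Literature.RingTheory.CentralSimple.BilinFormAdjoint.exists_nondegenerate_forall_adjoint` (every linear anti-automorphism
  of `End_F(V)` is the adjoint anti-automorphism of a nonsingular bilinear form) and ★ `forall_symm_or_forall_skew_of_adjoint_apply_apply`
  (period `2` ⇒ the form is symmetric or skew-symmetric; skew-symmetric = alternating in characteristic `0`).
* §3–§4 «In the second case `B` is isomorphic to a product `M × M^opp` with involution given by `(x, y) ↦ (y, x)`» («the product of two
  simple algebras interchanged by `*`»): take a maximal two-sided ideal `J ≠ 0` of `B` (a coatom of `TwoSidedIdeal B`, which is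
  coatomic since it embeds in the Noetherian lattice of `F`-subspaces; `J ≠ 0` because `B` is not simple) and `I = *⁻¹(J) = J*`; the
  ideals `I ∩ J` and `I + J` are `*`-stable, so irreducibility gives `I ∩ J = 0`, `I + J = B`, and `x ↦ (x mod J, (x* mod J)^op)` is an
  `F`-algebra isomorphism `B ≅ M × M^opp`, `M = B/J` (injective by `I ∩ J = 0`, surjective by `I + J = B`), carrying `*` to
  `(x, y) ↦ (y, x)`; `M = B/J` is simple (`J` maximal: Mathlib `RingCon.correspondence`), finite-dimensional, hence «a matrix algebra»
  (Wedderburn–Artin again).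
HONEST LABEL: HC_CM is proved only modulo the 7 printed citations (2 remaining: hLiu418, h413) until rung 0 closes; this file adds no citation
debt (0 facts, 0 sorry) and discharges 1 named fact of ★ `Involutions`.

## References
* [Kottwitz1992] R. E. Kottwitz, Points on some Shimura varieties over finite fields, J. Amer. Math. Soc. 5 (1992) 373–444, §1 p. 378.
* [KnusEtAl1998] M.-A. Knus, A. Merkurjev, M. Rost, J.-P. Tignol, The Book of Involutions, AMS Coll. Publ. 44 (1998), Ch. I,
  introduction, Theorem pp. 1–2 (the tree's `AdjointAntiAutomorphismsBilinearForms`).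
-/

noncomputable section

namespace Literature.NumberTheory.Kottwitz1992.Involutions

open Literature.RingTheory.CentralSimple

/-! ## §1 Involutions: unit and scalars -/

section Basics

variable {F : Type*} [Field F] {B : Type*} [Ring B] [Algebra F B] {ι : B →ₗ[F] B}

/-- An involution fixes `1`. [cite: Kottwitz1992, §1 (p. 378)] -/
private theorem invol_map_one (hι : IsInvolution F B ι) : ι 1 = 1 := by
  have h : ι (ι 1 * 1) = ι 1 * ι (ι 1) := hι.map_mul (ι 1) 1
  rw [mul_one, hι.apply_apply, mul_one] at h
  exact h.symm

/-- An (`F`-linear) involution fixes the scalars `F ⊆ B`. [cite: Kottwitz1992, §1 (p. 378)] -/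
private theorem invol_algebraMap (hι : IsInvolution F B ι) (r : F) : ι (algebraMap F B r) = algebraMap F B r := by
  rw [Algebra.algebraMap_eq_smul_one, map_smul, invol_map_one hι]

end Basics

/-! ## §2 «In the first case `B` is a matrix algebra over `F` …»: the simple case -/

section SimpleCase

variable {F : Type*} [Field F] {B : Type*} [Ring B] [Algebra F B] {ι : B →ₗ[F] B}

/-- **The first irreducible case.**  `B` simple, finite-dimensional over the algebraically closed `F` (characteristic `0`): `B ≅ End_F(F^n)`
(Wedderburn–Artin), and the transported involution `e ∘ * ∘ e⁻¹`, a linear anti-automorphism of `End_F(F^n)` of period `2`, is the adjoint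
anti-automorphism of a nondegenerate symmetric or alternating bilinear form (KMRT Ch. I Theorem, the tree's `BilinFormAdjoint`): «the
involution differs from the standard transpose involution by an inner automorphism `x ↦ y x y⁻¹`. The equality `x** = x` implies that `y`
is either symmetric or alternating». [cite: Kottwitz1992, §1 (p. 378)] -/
private theorem simple_case [IsAlgClosed F] [CharZero F] [FiniteDimensional F B] [IsSimpleRing B] (hι : IsInvolution F B ι) :
    ∃ (n : ℕ) (φ : LinearMap.BilinForm F (Fin n → F)) (e : B ≃ₐ[F] Module.End F (Fin n → F)),
      φ.Nondegenerate ∧ (φ.IsSymm ∨ φ.IsAlt) ∧ ∀ x : B, LinearMap.IsAdjointPair φ φ (e x) (e (ι x)) := by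
  -- «`B` is a matrix algebra over `F`»
  obtain ⟨n, _, ⟨g⟩⟩ := IsSimpleRing.exists_algEquiv_matrix_of_isAlgClosed F B
  let e : B ≃ₐ[F] Module.End F (Fin n → F) := g.trans Matrix.toLinAlgEquiv'
  -- the transported involution `σ' = e ∘ * ∘ e⁻¹` of `End_F(F^n)`
  let σ' : Module.End F (Fin n → F) →ₗ[F] Module.End F (Fin n → F) :=
    (e.toLinearEquiv : B →ₗ[F] Module.End F (Fin n → F)) ∘ₗ ι ∘ₗ
      (e.symm.toLinearEquiv : Module.End F (Fin n → F) →ₗ[F] B)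
  have hσ' : ∀ f, σ' f = e (ι (e.symm f)) := fun f => rfl
  have mul' : ∀ f f', σ' (f * f') = σ' f' * σ' f := fun f f' => by
    rw [hσ', hσ', hσ', map_mul, hι.map_mul, map_mul]
  have one' : σ' 1 = 1 := by rw [hσ', map_one, invol_map_one hι, map_one]
  have inv' : ∀ f, σ' (σ' f) = f := fun f => by
    rw [hσ', hσ', e.symm_apply_apply, hι.apply_apply, e.apply_symm_apply]
  -- KMRT Ch. I Theorem: `σ'` is the adjoint anti-automorphism of a nonsingular form, symmetric or skew since `σ'² = 1`
  obtain ⟨φ, hφ, hadj⟩ := BilinFormAdjoint.exists_nondegenerate_forall_adjoint σ' mul' one'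
  refine ⟨n, φ, e, hφ, ?_, fun x v w => ?_⟩
  · rcases BilinFormAdjoint.forall_symm_or_forall_skew_of_adjoint_apply_apply φ σ' hadj hφ inv' with h | h
    · exact Or.inl ⟨fun v w => h w v⟩
    · -- skew-symmetric ⇒ alternating (characteristic `0`)
      refine Or.inr ?_
      intro v
      have h2 : (2 : F) * φ v v = 0 := by
        rw [two_mul]
        nth_rewrite 1 [h v v]
        rw [neg_add_cancel]
      exact (mul_eq_zero.mp h2).resolve_left two_ne_zero
  · -- `φ (e x v) w = φ v (e x* w)`: the adjoint of `e x*` is `σ' (e x*) = e x** = e x`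
    have h := hadj (e (ι x)) v w
    rw [hσ', e.symm_apply_apply, hι.apply_apply] at h
    exact h

end SimpleCase

/-! ## §3 Two-sided ideals: maximal ideals exist, and the quotient by a maximal ideal is simple -/

section Ideals

variable {F : Type*} [Field F] {B : Type*} [Ring B] [Algebra F B]

variable (F B) in
/-- The lattice of two-sided ideals of the finite-dimensional `B` embeds in the Noetherian lattice of `F`-subspaces, so it is coatomic:
every proper two-sided ideal lies in a maximal one. [folklore] -/
private theorem isCoatomic_twoSidedIdeal [FiniteDimensional F B] : IsCoatomic (TwoSidedIdeal B) := by
  let f : TwoSidedIdeal B ↪o Submodule F B := OrderEmbedding.ofMapLEIff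
    (fun I => (TwoSidedIdeal.asIdeal I).restrictScalars F) fun I J => by
      constructor
      · intro h x hx
        exact TwoSidedIdeal.mem_asIdeal.mp (h (TwoSidedIdeal.mem_asIdeal.mpr hx : x ∈ (TwoSidedIdeal.asIdeal I).restrictScalars F))
      · intro h x hx
        exact (TwoSidedIdeal.mem_asIdeal.mpr (h (TwoSidedIdeal.mem_asIdeal.mp hx)) :
          x ∈ (TwoSidedIdeal.asIdeal J).restrictScalars F)
  haveI : WellFoundedGT (TwoSidedIdeal B) := f.wellFoundedGT
  exact isCoatomic_of_orderTop_gt_wellFounded wellFounded_gt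

omit [Algebra F B] in
/-- The quotient of `B` by a maximal two-sided ideal `J` is a simple ring (two-sided ideals of `B/J` ↔ two-sided ideals of `B` above `J`,
Mathlib `RingCon.correspondence`). [folklore] -/
private theorem isSimpleRing_quotient_of_isCoatom {J : TwoSidedIdeal B} (hJ : IsCoatom J) : IsSimpleRing J.ringCon.Quotient := by
  have h1 : IsCoatom J.ringCon := ((TwoSidedIdeal.orderIsoRingCon (R := B)).isCoatom_iff J).mpr hJ
  have h2 : IsSimpleOrder (Set.Ici J.ringCon) := Set.isSimpleOrder_Ici_iff_isCoatom.mpr h1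
  have h3 : IsSimpleOrder (RingCon J.ringCon.Quotient) := (RingCon.correspondence (c := J.ringCon)).symm.isSimpleOrder_iff.mpr h2
  exact ⟨(TwoSidedIdeal.orderIsoRingCon (R := J.ringCon.Quotient)).isSimpleOrder_iff.mpr h3⟩

end Ideals

/-! ## §4 «In the second case `B` is isomorphic to a product `M × M^opp` with involution given by `(x, y) ↦ (y, x)` …» -/

section NonsimpleCase

variable {F : Type*} [Field F] {B : Type*} [Ring B] [Algebra F B] {ι : B →ₗ[F] B}

/-- **The second irreducible case.**  `(B, *)` irreducible, finite-dimensional over the algebraically closed `F`, `B` NOT simple: with `J`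
a maximal two-sided ideal (`J ≠ 0`) and `I = *⁻¹(J) = J*`, irreducibility gives `I ∩ J = 0` and `I + J = B` (both are `*`-stable), so
`x ↦ (x mod J, (x* mod J)^op)` is an isomorphism `(B, *) ≅ (M × M^opp, (x, y) ↦ (y, x))` with `M = B/J ≅ M_n(F)` simple («the product of
two simple algebras interchanged by `*`»). [cite: Kottwitz1992, §1 (p. 378)] -/
private theorem nonsimple_case [IsAlgClosed F] [FiniteDimensional F B] (hι : IsInvolution F B ι) (hirr : IsIrreducible ι)
    (hB : ¬ IsSimpleRing B) :
    ∃ (n : ℕ) (e : B ≃ₐ[F] (Matrix (Fin n) (Fin n) F × (Matrix (Fin n) (Fin n) F)ᵐᵒᵖ)),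
      ∀ x : B, e (ι x) = (MulOpposite.unop (e x).2, MulOpposite.op (e x).1) := by
  obtain ⟨hnt, hirr⟩ := hirr
  -- a maximal two-sided ideal `J`; `J ≠ 0` since `B` is not simple
  haveI := isCoatomic_twoSidedIdeal F B
  obtain ⟨J, hJ, -⟩ := (eq_top_or_exists_le_coatom (⊥ : TwoSidedIdeal B)).resolve_left bot_ne_top
  have hJbot : J ≠ ⊥ := by
    rintro rfl
    exact hB ⟨isSimpleOrder_iff_isCoatom_bot.mpr hJ⟩
  -- `I = *⁻¹(J) = J*`, a two-sided ideal
  let I : TwoSidedIdeal B := TwoSidedIdeal.mk' {x | ι x ∈ J}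
    (show ι 0 ∈ J by rw [map_zero]; exact J.zero_mem)
    (fun {x y} hx hy => show ι (x + y) ∈ J by rw [map_add]; exact J.add_mem hx hy)
    (fun {x} hx => show ι (-x) ∈ J by rw [map_neg]; exact J.neg_mem hx)
    (fun {x y} hy => show ι (x * y) ∈ J by rw [hι.map_mul]; exact J.mul_mem_right _ _ hy)
    (fun {x y} hx => show ι (x * y) ∈ J by rw [hι.map_mul]; exact J.mul_mem_left _ _ hx)
  have hI : ∀ x, x ∈ I ↔ ι x ∈ J := fun x => TwoSidedIdeal.mem_mk' _ _ _ _ _ _ x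
  -- `I ∩ J` is `*`-stable and `≠ B`, hence `0`
  have hinf : I ⊓ J = ⊥ := by
    have hst : ∀ x ∈ I ⊓ J, ι x ∈ I ⊓ J := fun x hx =>
      ⟨(hI _).mpr (by rw [hι.apply_apply]; exact hx.2), (hI _).mp hx.1⟩
    rcases hirr (I ⊓ J) hst with h | h
    · exact h
    · exact absurd h (ne_of_lt (lt_of_le_of_lt inf_le_right hJ.1.lt_top))
  -- `I + J` is `*`-stable and `≠ 0`, hence `B`
  have hsup : I ⊔ J = ⊤ := by
    have hst : ∀ x ∈ I ⊔ J, ι x ∈ I ⊔ J := fun x hx => by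
      obtain ⟨y, hy, z, hz, rfl⟩ := TwoSidedIdeal.mem_sup.mp hx
      rw [map_add, add_comm]
      exact TwoSidedIdeal.mem_sup.mpr ⟨ι z, (hI _).mpr (by rw [hι.apply_apply]; exact hz), ι y, (hI _).mp hy, rfl⟩
    rcases hirr (I ⊔ J) hst with h | h
    · exact absurd (le_bot_iff.mp (h ▸ le_sup_right : J ≤ ⊥)) hJbot
    · exact h
  -- `M = B/J` and `x ↦ (x mod J, (x* mod J)^op)`
  let M : Type _ := J.ringCon.Quotient
  let π : B →+* M := J.ringCon.mk'
  have hπ : ∀ y, π y = 0 ↔ y ∈ J := fun y => by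
    have h := TwoSidedIdeal.mem_ker J.ringCon.mk' (x := y)
    rw [TwoSidedIdeal.ker_ringCon_mk'] at h
    exact h.symm
  have hπalg : ∀ r : F, π (algebraMap F B r) = algebraMap F M r := fun r => rfl
  let e₀ : B →ₐ[F] M × Mᵐᵒᵖ :=
    { toFun := fun x => (π x, MulOpposite.op (π (ι x)))
      map_one' := by
        show (π 1, MulOpposite.op (π (ι 1))) = 1
        rw [invol_map_one hι, map_one, MulOpposite.op_one]
        rfl
      map_mul' := fun x y => by
        show (π (x * y), MulOpposite.op (π (ι (x * y)))) = (π x, MulOpposite.op (π (ι x))) * (π y, MulOpposite.op (π (ι y)))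
        rw [hι.map_mul, map_mul, map_mul, MulOpposite.op_mul]
        rfl
      map_zero' := by
        show (π 0, MulOpposite.op (π (ι 0))) = 0
        rw [map_zero, map_zero, map_zero, MulOpposite.op_zero]
        rfl
      map_add' := fun x y => by
        show (π (x + y), MulOpposite.op (π (ι (x + y)))) = (π x, MulOpposite.op (π (ι x))) + (π y, MulOpposite.op (π (ι y)))
        rw [map_add, map_add, map_add, MulOpposite.op_add]
        rfl
      commutes' := fun r => by
        show (π (algebraMap F B r), MulOpposite.op (π (ι (algebraMap F B r)))) = algebraMap F (M × Mᵐᵒᵖ) r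
        rw [invol_algebraMap hι, hπalg]
        rfl }
  have he₀ : ∀ x, e₀ x = (π x, MulOpposite.op (π (ι x))) := fun x => rfl
  -- injective: `x ∈ J` and `x* ∈ J` means `x ∈ I ∩ J = 0`
  have hinj : Function.Injective e₀ := by
    rw [injective_iff_map_eq_zero]
    intro x hx
    rw [he₀, Prod.ext_iff] at hx
    have h1 : x ∈ J := (hπ x).mp hx.1
    have h2 : x ∈ I := (hI x).mpr ((hπ _).mp (MulOpposite.op_injective hx.2))
    have h3 : x ∈ I ⊓ J := ⟨h2, h1⟩
    rwa [hinf, TwoSidedIdeal.mem_bot] at h3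
  -- surjective: Chinese remainder from `I + J = B`
  have hsurj : Function.Surjective e₀ := by
    rintro ⟨a', b'⟩
    obtain ⟨a, rfl⟩ := J.ringCon.mk'_surjective a'
    obtain ⟨b, hb⟩ := J.ringCon.mk'_surjective (MulOpposite.unop b')
    have hmem : a - ι b ∈ I ⊔ J := by rw [hsup]; exact TwoSidedIdeal.mem_top B
    obtain ⟨i, hi, j, hj, hij⟩ := TwoSidedIdeal.mem_sup.mp hmem
    have h4 : a - j = i + ι b := by
      calc a - j = a - ι b + ι b - j := by rw [sub_add_cancel]
        _ = i + j + ι b - j := by rw [hij]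
        _ = i + ι b := by abel
    refine ⟨a - j, ?_⟩
    rw [he₀, Prod.ext_iff]
    constructor
    · show π (a - j) = π a
      rw [map_sub, (hπ j).mpr hj, sub_zero]
    · show MulOpposite.op (π (ι (a - j))) = b'
      rw [← MulOpposite.op_unop b', ← hb, h4, map_add, hι.apply_apply, map_add, (hπ (ι i)).mpr ((hI i).mp hi), zero_add]
  -- `M = B/J` is simple and finite-dimensional: «a matrix algebra»
  haveI : IsSimpleRing M := isSimpleRing_quotient_of_isCoatom hJ
  haveI : FiniteDimensional F M := Module.Finite.of_surjective (RingCon.mkₐ F J.ringCon).toLinearMap fun m => by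
    obtain ⟨x, hx⟩ := J.ringCon.mk'_surjective m
    exact ⟨x, hx⟩
  obtain ⟨n, _, ⟨g⟩⟩ := IsSimpleRing.exists_algEquiv_matrix_of_isAlgClosed F M
  let e : B ≃ₐ[F] (Matrix (Fin n) (Fin n) F × (Matrix (Fin n) (Fin n) F)ᵐᵒᵖ) :=
    (AlgEquiv.ofBijective e₀ ⟨hinj, hsurj⟩).trans (AlgEquiv.prodCongr g (AlgEquiv.op g))
  have he : ∀ x, e x = (g (π x), MulOpposite.op (g (π (ι x)))) := fun x => rfl
  refine ⟨n, e, fun x => ?_⟩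
  rw [he, he, hι.apply_apply]
  rfl

end NonsimpleCase

/-! ## §5 The classification -/

section Classification

variable (F : Type*) [Field F] (B : Type*) [Ring B] [Algebra F B] (ι : B →ₗ[F] B)

/-- **§1 CLASSIFICATION, PROVED**: ★ `Kottwitz1992_1_irreducible_classification` holds — for `F` algebraically closed of characteristic
`0` and `(B, *)` finite-dimensional semisimple irreducible, either `(B, *) ≅ (End_F(F^n), σ_φ)` for a nondegenerate symmetric or
alternating bilinear form `φ` («the first case»: `B` simple, Wedderburn–Artin + KMRT Ch. I Theorem), or `(B, *) ≅ (M × M^opp, (x, y) ↦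
(y, x))` with `M` a matrix algebra («the second case»: `B` not simple, `B = J* ⊕ J` for a maximal ideal `J`).
[cite: Kottwitz1992, §1 (p. 378)] -/
theorem Kottwitz1992_1_irreducible_classification_holds : Kottwitz1992_1_irreducible_classification F B ι := by
  intro _ _ _ _ hι hirr
  by_cases hB : IsSimpleRing B
  · exact Or.inl (simple_case hι)
  · exact Or.inr (nonsimple_case hι hirr hB)

end Classification

end Literature.NumberTheory.Kottwitz1992.Involutions

end
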